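import Summits.QuantumFields.YangMills.Theorems.UnitScaleTiltHalvingP1FlatCoreDP1Target
import Summits.QuantumFields.YangMills.Theorems.UnitScaleTiltHalvingP1FlatCoreCubeInclusion
import Literature.MathematicalPhysics.QuantumFieldTheory.Balaban1983to89.B8CubeMemberZd
import HarnessLib

/-!
# Route `UnitScaleTilt`, crux K1 child «MinimiserStabilityRegPr» (stmt-QuantumFields-19200), registered stub V2′ `stub_halvingStep` (v10 `BirthV10`) —
# **J7: `dp1Clause_of_top` — CLAUSE (o) OF THE FLAT CORE FROM THE TOP STEP'S OUTPUT (top)**, read on pub-ymgap N05's top index layer `Λs k` (`k = K − n`)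
# through the level-`k` cover, with the no-wrap side condition discharged from LEAD-H's ROOM binder `2·ρ + N_r ≤ L^{F.m+n}`

Cell `ym3-torus` (HUMAN RULING D-0037, YM ladder rung R3 — continuum SU(2) YM₃ on the three-torus is a RUNG, NOT the Clay problem), width seat `ym-ust-19936-w7`
(explicit unit, gen 4); LEAD-H (`ym-ust-19200-w5` g4) 2026-08-28T12:30:56Z Q3 «WHO composes `DP1Clause`: → ★w7-19936 g4 — row J7 `dp1Clause_of_top`».
`--supports stmt-QuantumFields-19200 --as helper`; THEOREMS ONLY (0 `def`, 0 `sorry`); count-neutral; nothing here claims the stub, the crux, d = 4 or the gap.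

WHAT.  ✓`P1FlatCoreDP1Target.dp1Clause_of_effGauge_eq_axialT_dbar` (the (o)-target, final form) concludes `DP1Clause F n K D x U u` from the chart-gauge
factorisation `u⁻¹ = C·h′·g`, the effective-gauge recursion `κ′` of `h′` down the double-bar tower of `W₁ = (U♯)^{g}`, the accumulated frames `ν`, the descended
pre-gauge `g_i`, the fine-regularity guard, the no-wrap condition `hwrap` of the top window, and the TOP IDENTITY `hlam : κ′_k(y) = v₀(W̿₁^{(k)}; y₀, y)` for the
TORUS top sites `y ∈ D.Om (K−n)`.  The J4 pair's top step ((T4b), ★w8-19936 g2 `T4B-LOCATE-w8g2.md` §0) emits this identity in ℤ³ LETTERS — (top):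
`κ′ k (y♭ y) = axialT (dbarIterU k W₁) y₀ (y♭ y)` for every coarse integer point `y ∈ Λs k` of N05's top index layer, `y♭ y := iterBlockOf k (cover ((Lᵏ:ℤ)•y))`.
This file composes the two at the route's window `D := cubeSeqMT3 F n K x ρ S M hM`:
* §1 `transl_zero_eq_coverAt`, `flm_pow_smul`, ★`iterBlockOf_cover_smul` — the top-site map IS n07's level-`k` cover: `y♭ y = coverAt k y` (`k ≤ m + K`; no room premise);
* §2 `natAbs_rel_le_of_mem_Om_top`, ★`exists_coarseRep_of_mem_Om_top` — every torus site `y_t` of the route's top layer `D.Om (K−n)` is `coverAt k y` for the coarse point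
  `y := val(y₀) + rel y₀ y_t` of N05's top box `[a − ρ′, a + M′ − 1 + ρ′]` (`sqLo ∕ sqHi` at `j = k`), as soon as `ρ + M ≤ ρ′ + 1` and the corner `a` frames `y₀ = Bᵏx`
  (the J1b binders `h0`, `ha` of ✓`P1FlatCoreCubeInclusion`; pure level-`k` label arithmetic, the same as ✓`P1FlatCoreDP1Target.two_mul_rel_succ_le_of_room`);
  `mem_LamP_top_of_inBox` ∕ `mem_cubeLam_top_of_inBox` — that box IS print's `Λ′_k = LamP … k k` = the member's `cubeLam … k k` (`1 ≤ k`);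
* §3 ★★★`dp1Clause_of_top` — (top) on an abstract top layer `Λs (K−n) ⊇` the top box (hypothesis `hΛ`, discharged by §2 for `LamP`∕`cubeLam`), in the `coverAt`
  spelling, + the binders of ✓`dp1Clause_of_effGauge_eq_axialT_dbar` VERBATIM (minus `hwrap`, which comes from the room binder by ✓`hwrap_of_roomBinder`) ⟹
  `DP1Clause F n K (cubeSeqMT3 F n K x ρ S M hM) x U u`;  `dp1Clause_of_top_flat` — the same with (top) in the pair's `y♭` spelling
  `iterBlockOf (K−n) (cover ((L:ℤ)^(K−n) • y))`;  `dp1Clause_of_top_junction` — the same at J6's torus gauge `u := fun s => suIncl (w (lift x + rel x s))`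
  (✓`HalvingP1FlatCoreJunction.junction_chart` ∕ ✓`HalvingP1FlatCoreExtraction.core'_of_mlogChart` letters), i.e. the `ho` row of the per-site checklist of record.

HONEST SCOPE: rewriting along landed identities plus label arithmetic; no analysis.  Nothing here proves (top), `core′`, the stub or the crux.

References: T. Bałaban, *Averaging operations for lattice gauge theories*, CMP **98** (1985) 17–51 [Balaban1985Averaging] ((8) p.19, (92) p.31, (97)–(100) p.32);
*Spaces of regular gauge field configurations on a lattice and gauge fixing conditions*, CMP **99** (1985) 75–102 [Balaban1985RegularSpaces] ((1.131) p.99, p.98);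
*The variational problem …*, CMP **102** (1985) 277–309 [Balaban1985Variational] ((144) p.300, (156) p.302); *Propagators … I*, CMP **95** (1984) 17–40
[Balaban1984PropagatorsI] ((1.18) p.20); *Renormalization group approach … I*, CMP **109** (1987) 249–301 [Balaban1987RG1] ((0.1) p.251).
-/

set_option autoImplicit false

open scoped Matrix.Norms.L2Operator

namespace Summit.QuantumFields.YangMills.Theorems.HalvingP1FlatCoreDP1OfTop

open Literature.MathematicalPhysics.QuantumFieldTheory.Balaban1983to89
open T4Continuum BlockAveraging ExpMeanLog
open T3ContinuumYM3Torus T3RegularMinimiser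
open Literature.MathematicalPhysics.QuantumFieldTheory.Balaban1983to89.T3UnitLawDensityEML (ℰp)
open B5Eq117TorusCarriers (Mk)
open B5Eq118OneStroke (iterBlockOf)
open B5Prop12FieldsLattice (distSite)
open B10Eq27TorusAxialLog (unitsField toUField gaugeActT axialT rel rel_apply transl transl_apply suIncl)
open B7Prop1Explicit renaming Site → LSite
open B7Prop1Local (InBox)
open B8Eq131Cubes (cube LamP flm sqLo sqHi bLo bHi gs_zero)
open B8CubeMemberZd (cubeLam cubeLam_eq_LamP)
open B15Eq112TorusCover (cover lift)
open Node00 (coverAt coverAt_apply iterBlockOf_cover)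
open Literature.MathematicalPhysics.QuantumLattice (blockMap)
open Summit.QuantumFields.YangMills.Theorems.FlatCubeSequenceAligned (cubeFinM cubeSeqMT3 mem_cubeFinM_iff cubeSeqM_Om_pos natAbs_valMinAbs_sub_le_of_div_eq)
open Summit.QuantumFields.YangMills.Theorems (FlatMinimizerH.le_T3)
open Summit.QuantumFields.YangMills.Theorems.Prop8ChartDoubleBar (dbarIterU vframeU)
open Summit.QuantumFields.YangMills.Theorems.HalvingP1FlatPillar (DP1Clause)
open Summit.QuantumFields.YangMills.Theorems.P1FlatCoreDP1Target (dp1Clause_of_effGauge_eq_axialT_dbar hwrap_of_roomBinder)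
open Summit.QuantumFields.YangMills.Theorems.P1FlatCoreCubeInclusion (transl_zero_valRep_add_rel blockMap_pow_eq_flm)

/-! ## §1 The top-site map `y♭` is the level-`k` cover -/

section Cover

variable {P : Params}

/-- J3's base-point-`0` translate at level `j` IS n07's level-`j` cover: `transl (0 : T^{(j)}) z = coverAt j z`. [cite: Balaban1987RG1, (0.1) p.251, bookkeeping] -/
theorem transl_zero_eq_coverAt (j : ℕ) (z : LSite P.d) : transl (0 : Site P j) z = coverAt P j z := by
  funext ν
  rw [transl_apply, coverAt_apply]
  exact zero_add _

/-- `⌊(Lᵏ•y)∕Lᵏ⌋ = y`: the block label of a block corner. [folklore] -/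
theorem flm_pow_smul {d : ℕ} {L : ℕ} (hL : 1 ≤ L) (k : ℕ) (y : LSite d) : flm L k (((L : ℤ) ^ k) • y) = y := by
  funext i
  simp only [flm, Pi.smul_apply, smul_eq_mul]
  exact Int.mul_ediv_cancel_left _ (pow_ne_zero _ (by exact_mod_cast (show L ≠ 0 by omega)))

/-- ★ **THE TOP-SITE MAP IS THE LEVEL-`k` COVER**: `iterBlockOf k (cover (Lᵏ•y)) = coverAt k y` (`k ≤ m + K`) — the `k`-fold block point of the covered block
corner `Lᵏ•y` is the level-`k` torus site with labels `y` (✓`Node00.iterBlockOf_cover`, `⌊(Lᵏ•y)∕Lᵏ⌋ = y`).  No room premise.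
[cite: Balaban1984PropagatorsI, (1.18) p.20; Balaban1987RG1, (0.1) p.251] -/
theorem iterBlockOf_cover_smul {k : ℕ} (hk : k ≤ P.m + P.K) (y : LSite P.d) :
    iterBlockOf k (cover P (((P.L : ℤ) ^ k) • y)) = coverAt P k y := by
  rw [iterBlockOf_cover hk, blockMap_pow_eq_flm, flm_pow_smul P.L_pos]

/-- print's top layer `Λ′_k = LamP … k k` contains every coarse point of the top box `[sqLo, sqHi]_{j = k}` (`1 ≤ k`; at `j = k` there is no inner exclusion).
[cite: Balaban1985RegularSpaces, (1.131) p.99] -/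
theorem mem_LamP_top_of_inBox {d : ℕ} {L : ℕ} {a : LSite d} {M ρ k : ℕ} (hk : 1 ≤ k) {z : LSite d}
    (hz : InBox (sqLo L a ρ k k) (sqHi L a M ρ k k) z) : z ∈ LamP L a M ρ k k := by
  have hk0 : k ≠ 0 := by omega
  simp only [LamP, if_neg hk0, Set.mem_setOf_eq]
  exact ⟨hz, fun h => absurd h (lt_irrefl k)⟩

/-- the same for the cube member's restriction layers `cubeLam` (`= LamP` at levels `≥ 1`, ✓`B8CubeMemberZd.cubeLam_eq_LamP`). [cite: Balaban1985RegularSpaces, (1.131) p.99] -/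
theorem mem_cubeLam_top_of_inBox {d : ℕ} {L : ℕ} {a : LSite d} {M ρ k : ℕ} (hk : 1 ≤ k) {z : LSite d}
    (hz : InBox (sqLo L a ρ k k) (sqHi L a M ρ k k) z) : z ∈ cubeLam L a M ρ k k := by
  rw [cubeLam_eq_LamP L a M ρ k hk]
  exact mem_LamP_top_of_inBox hk hz

end Cover

/-! ## §2 Every torus site of the route's top layer has a coarse representative in N05's top box -/

variable (F : T3Family) (n K : ℕ)

/-- the relative position of a site of the route's top layer `D.Om (K−n)` (`D = cubeSeqMT3 …`: the `M`-saturated ball of radius `ρ` about `y₀ = Bᵏx`) from `y₀` has every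
coordinate of absolute value `≤ ρ + M − 1` (label arithmetic of ✓`P1FlatCoreDP1Target.two_mul_rel_succ_le_of_room`). [cite: Balaban1985Variational, (144) p.300, bookkeeping] -/
theorem natAbs_rel_le_of_mem_Om_top (hnK : n < K) {ρ S M : ℕ} (hM : 1 ≤ M) (x : Site (F.P K) 0) (y : Site (F.P K) (K - n))
    (hy : y ∈ (cubeSeqMT3 F n K x ρ S M hM).Om (K - n)) (μ : Fin (F.P K).d) :
    (rel (iterBlockOf (K - n) x) y μ).natAbs ≤ ρ + (M - 1) := by
  -- adapted from ✓`P1FlatCoreDP1Target.two_mul_rel_succ_le_of_room` (steps h1–h3)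
  have hk1 : 1 ≤ K - n := by omega
  have hOm : (cubeSeqMT3 F n K x ρ S M hM).Om (K - n) = cubeFinM x (K - n) ρ S M (K - n) :=
    cubeSeqM_Om_pos x (FlatMinimizerH.le_T3 F n K) ρ S M hM hk1 le_rfl
  rw [hOm, mem_cubeFinM_iff] at hy
  obtain ⟨y₀, hlab, hdist⟩ := hy
  rw [Nat.sub_self] at hdist
  have h1 : ((y₀ μ - (iterBlockOf (K - n) x) μ).valMinAbs).natAbs ≤ ρ := by
    have hle := Finset.le_sup (f := fun ν : Fin (F.P K).d => ((y₀ ν - (iterBlockOf (K - n) x) ν).valMinAbs).natAbs)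
      (Finset.mem_univ μ)
    have hsup : ((Finset.univ.sup fun ν : Fin (F.P K).d => ((y₀ ν - (iterBlockOf (K - n) x) ν).valMinAbs).natAbs : ℕ) : ℝ) ≤
        (ρ : ℝ) := hdist
    exact_mod_cast (Nat.cast_le.2 hle).trans hsup
  have h2 : ((y μ - y₀ μ).valMinAbs).natAbs ≤ M - 1 := by
    rw [← ZMod.natAbs_valMinAbs_neg, neg_sub]
    exact natAbs_valMinAbs_sub_le_of_div_eq hM (y₀ μ) (y μ) (hlab μ)
  rw [rel_apply]
  have hsplit : y μ - (iterBlockOf (K - n) x) μ = (y μ - y₀ μ) + (y₀ μ - (iterBlockOf (K - n) x) μ) := by abel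
  rw [hsplit]
  refine (ZMod.natAbs_valMinAbs_add_le _ _).trans ((Int.natAbs_add_le _ _).trans ?_)
  omega

/-- ★ **THE COARSE REPRESENTATIVE OF A TOP-LAYER SITE**: for `y_t ∈ D.Om (K−n)` the integer point `y := val(y₀) + rel y₀ y_t` (`y₀ = Bᵏx`) lies in N05's top box
`[a − ρ′, a + M′ − 1 + ρ′] = [sqLo, sqHi]_{j = k}` and covers `y_t` at level `k`: `coverAt (K−n) y = y_t` — as soon as `ρ + M ≤ ρ′ + 1` and the corner `a` frames `y₀`
(`a ≤ val y₀ ≤ a + M′ − 1`, the J1b binders).  Pure level-`k` label arithmetic; no room premise. [cite: Balaban1985RegularSpaces, p.98; Balaban1985Variational, (144) p.300;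
Balaban1987RG1, (0.1) p.251, bookkeeping] -/
theorem exists_coarseRep_of_mem_Om_top (hnK : n < K) {ρ S M : ℕ} (hM : 1 ≤ M) (x : Site (F.P K) 0)
    {a : LSite (F.P K).d} {M' ρ' : ℕ} (h0 : ρ + M ≤ ρ' + 1)
    (ha : ∀ ν, a ν ≤ ((iterBlockOf (K - n) x ν).val : ℤ) ∧ ((iterBlockOf (K - n) x ν).val : ℤ) ≤ a ν + M' - 1)
    (y : Site (F.P K) (K - n)) (hy : y ∈ (cubeSeqMT3 F n K x ρ S M hM).Om (K - n)) :
    ∃ yc : LSite (F.P K).d, InBox (sqLo (F.P K).L a ρ' (K - n) (K - n)) (sqHi (F.P K).L a M' ρ' (K - n) (K - n)) yc ∧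
      coverAt (F.P K) (K - n) yc = y := by
  refine ⟨(fun ν => ((iterBlockOf (K - n) x ν).val : ℤ)) + rel (iterBlockOf (K - n) x) y, ?_, ?_⟩
  · intro i
    have h := natAbs_rel_le_of_mem_Om_top F n K hnK hM x y hy i
    have hai := ha i
    have hr : rel (iterBlockOf (K - n) x) y i ≤ (ρ : ℤ) + (M - 1 : ℕ) ∧ -((ρ : ℤ) + (M - 1 : ℕ)) ≤ rel (iterBlockOf (K - n) x) y i := by
      have h' : ((rel (iterBlockOf (K - n) x) y i).natAbs : ℤ) ≤ (ρ : ℤ) + (M - 1 : ℕ) := by exact_mod_cast h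
      constructor <;> omega
    have hM1 : ((M - 1 : ℕ) : ℤ) = (M : ℤ) - 1 := by omega
    have hρ' : (ρ : ℤ) + (M : ℤ) ≤ (ρ' : ℤ) + 1 := by exact_mod_cast h0
    simp only [sqLo, sqHi, bLo, bHi, Nat.sub_self, pow_zero, one_mul, gs_zero, mul_one, Pi.add_apply]
    constructor <;> omega
  · rw [← transl_zero_eq_coverAt]
    exact transl_zero_valRep_add_rel _ _

/-! ## §3 ★★★ `dp1Clause_of_top` -/

/-- ★★★ **CLAUSE (o) FROM THE TOP STEP'S OUTPUT.**  Letters of ✓`P1FlatCoreDP1Target.dp1Clause_of_effGauge_eq_axialT_dbar` VERBATIM (chart gauge `u⁻¹ = C·h′·g`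
with `C = g_k(y₀)⁻¹·ν_k(y₀)`, effective gauges `κ′` of `h′` down the double-bar tower of `W₁ = (U♯)^{g}`, accumulated frames `ν`, descended pre-gauge `g_i`, the
fine-regularity guard `10⁷L³ε₀ ≤ 1` ∕ `PlaqSmall (regThreshold F n K ε₀) U`), at the route's window `D := cubeSeqMT3 F n K x ρ S M hM`, with
(i) the no-wrap condition DISCHARGED from LEAD-H's room binder `2·ρ + N_r ≤ L^{F.m+n}`, `M ≤ N_r` (✓`hwrap_of_roomBinder`), and
(ii) the top identity taken in the J4 pair's ℤ³ letters — (top): `κ′_k (coverAt k y) = v₀(W̿₁^{(k)}; y₀, coverAt k y)` for every coarse point `y` of an (abstract) top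
index layer `Λs (K−n)` containing N05's top box `[a − ρ′, a + M′ − 1 + ρ′]` (hypothesis `hΛ`; for print's `LamP`∕the member's `cubeLam` it is `mem_LamP_top_of_inBox` ∕
`mem_cubeLam_top_of_inBox`), the corner `a` framing `y₀ = Bᵏx` and `ρ + M ≤ ρ′ + 1` (J1b binders) — the restriction to the torus top layer `D.Om (K−n)` being
`exists_coarseRep_of_mem_Om_top`.  Conclusion: `DP1Clause F n K D x U u`. [cite: Balaban1985Averaging, (8) p.19, (92) p.31, (97)-(100) p.32; Balaban1985Variational,
(20) p.281, (144) p.300, (156) p.302; Balaban1985RegularSpaces, (1.131) p.99] -/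
theorem dp1Clause_of_top (hnK : n < K) (x : Site (F.P K) 0) {ρ S M Nr : ℕ} (hM : 1 ≤ M) (hNr : M ≤ Nr)
    (hroom : 2 * ρ + Nr ≤ F.L ^ (F.m + n))
    {a : LSite (F.P K).d} {M' ρ' : ℕ} (h0 : ρ + M ≤ ρ' + 1)
    (ha : ∀ ν, a ν ≤ ((iterBlockOf (K - n) x ν).val : ℤ) ∧ ((iterBlockOf (K - n) x ν).val : ℤ) ≤ a ν + M' - 1)
    (Λs : ℕ → Set (LSite (F.P K).d))
    (hΛ : ∀ yc : LSite (F.P K).d,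
      InBox (sqLo (F.P K).L a ρ' (K - n) (K - n)) (sqHi (F.P K).L a M' ρ' (K - n) (K - n)) yc → yc ∈ Λs (K - n))
    (U : GaugeField (F.P K) 0 (Matrix.specialUnitaryGroup (Fin 2) ℂ)) (u : GaugeTransf (F.P K) 0 (Matrix.unitaryGroup (Fin 2) ℂ))
    (g h' : GaugeTransf (F.P K) 0 (Matrix (Fin 2) (Fin 2) ℂ)ˣ)
    (κ' : (i : ℕ) → GaugeTransf (F.P K) i (Matrix (Fin 2) (Fin 2) ℂ)ˣ) (h0' : κ' 0 = h')
    (hs' : ∀ (i : ℕ) (y : Site (F.P K) (i + 1)),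
      κ' (i + 1) y = (vframeU (gaugeActT (κ' i) (dbarIterU i (gaugeActT g (unitsField (toUField U))))) y)⁻¹ * κ' i (emb y) *
        vframeU (dbarIterU i (gaugeActT g (unitsField (toUField U)))) y)
    (ν : (i : ℕ) → Site (F.P K) i → (Matrix (Fin 2) (Fin 2) ℂ)ˣ) (hν0 : ∀ s, ν 0 s = 1)
    (hνs : ∀ (i : ℕ) (y : Site (F.P K) (i + 1)),
      ν (i + 1) y = ν i (emb y) * vframeU (dbarIterU i (gaugeActT g (unitsField (toUField U)))) y)
    (gs : (i : ℕ) → GaugeTransf (F.P K) i (Matrix (Fin 2) (Fin 2) ℂ)ˣ) (hg0 : gs 0 = g)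
    (hgs : ∀ (i : ℕ) (y : Site (F.P K) (i + 1)), gs (i + 1) y = gs i (emb y))
    {ε₀ : ℝ} (hε₀ : 0 < ε₀) (hε : 10 ^ 7 * (F.L : ℝ) ^ 3 * ε₀ ≤ 1) (hU : PlaqSmall (regThreshold F n K ε₀) U)
    (hug : ∀ s, (Unitary.toUnits (u s))⁻¹ =
      ((gs (K - n) (iterBlockOf (K - n) x))⁻¹ * ν (K - n) (iterBlockOf (K - n) x)) * h' s * g s)
    (htop : ∀ yc ∈ Λs (K - n),
      κ' (K - n) (coverAt (F.P K) (K - n) yc) =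
        axialT (dbarIterU (K - n) (gaugeActT g (unitsField (toUField U)))) (iterBlockOf (K - n) x) (coverAt (F.P K) (K - n) yc)) :
    DP1Clause F n K (cubeSeqMT3 F n K x ρ S M hM) x U u :=
  dp1Clause_of_effGauge_eq_axialT_dbar F n K _ x U u g h' κ' h0' hs' ν hν0 hνs gs hg0 hgs hε₀ hε hU
    (hwrap_of_roomBinder F n K hnK hM hNr x hroom) hug fun y hy => by
      obtain ⟨yc, hbox, hyc⟩ := exists_coarseRep_of_mem_Om_top F n K hnK hM x h0 ha y hy
      rw [← hyc]
      exact htop yc (hΛ yc hbox)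

/-- **THE SAME WITH (top) IN THE PAIR'S `y♭` SPELLING** `y♭ y := iterBlockOf (K−n) (cover ((L:ℤ)^(K−n) • y))` ((T4b) memo §0∕§3 Q4; `= coverAt (K−n) y` by
`iterBlockOf_cover_smul`). [cite: Balaban1985Averaging, (8) p.19, (92) p.31, (97)-(100) p.32; Balaban1985Variational, (144) p.300, (156) p.302; Balaban1984PropagatorsI, (1.18) p.20] -/
theorem dp1Clause_of_top_flat (hnK : n < K) (x : Site (F.P K) 0) {ρ S M Nr : ℕ} (hM : 1 ≤ M) (hNr : M ≤ Nr)
    (hroom : 2 * ρ + Nr ≤ F.L ^ (F.m + n))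
    {a : LSite (F.P K).d} {M' ρ' : ℕ} (h0 : ρ + M ≤ ρ' + 1)
    (ha : ∀ ν, a ν ≤ ((iterBlockOf (K - n) x ν).val : ℤ) ∧ ((iterBlockOf (K - n) x ν).val : ℤ) ≤ a ν + M' - 1)
    (Λs : ℕ → Set (LSite (F.P K).d))
    (hΛ : ∀ yc : LSite (F.P K).d,
      InBox (sqLo (F.P K).L a ρ' (K - n) (K - n)) (sqHi (F.P K).L a M' ρ' (K - n) (K - n)) yc → yc ∈ Λs (K - n))
    (U : GaugeField (F.P K) 0 (Matrix.specialUnitaryGroup (Fin 2) ℂ)) (u : GaugeTransf (F.P K) 0 (Matrix.unitaryGroup (Fin 2) ℂ))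
    (g h' : GaugeTransf (F.P K) 0 (Matrix (Fin 2) (Fin 2) ℂ)ˣ)
    (κ' : (i : ℕ) → GaugeTransf (F.P K) i (Matrix (Fin 2) (Fin 2) ℂ)ˣ) (h0' : κ' 0 = h')
    (hs' : ∀ (i : ℕ) (y : Site (F.P K) (i + 1)),
      κ' (i + 1) y = (vframeU (gaugeActT (κ' i) (dbarIterU i (gaugeActT g (unitsField (toUField U))))) y)⁻¹ * κ' i (emb y) *
        vframeU (dbarIterU i (gaugeActT g (unitsField (toUField U)))) y)
    (ν : (i : ℕ) → Site (F.P K) i → (Matrix (Fin 2) (Fin 2) ℂ)ˣ) (hν0 : ∀ s, ν 0 s = 1)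
    (hνs : ∀ (i : ℕ) (y : Site (F.P K) (i + 1)),
      ν (i + 1) y = ν i (emb y) * vframeU (dbarIterU i (gaugeActT g (unitsField (toUField U)))) y)
    (gs : (i : ℕ) → GaugeTransf (F.P K) i (Matrix (Fin 2) (Fin 2) ℂ)ˣ) (hg0 : gs 0 = g)
    (hgs : ∀ (i : ℕ) (y : Site (F.P K) (i + 1)), gs (i + 1) y = gs i (emb y))
    {ε₀ : ℝ} (hε₀ : 0 < ε₀) (hε : 10 ^ 7 * (F.L : ℝ) ^ 3 * ε₀ ≤ 1) (hU : PlaqSmall (regThreshold F n K ε₀) U)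
    (hug : ∀ s, (Unitary.toUnits (u s))⁻¹ =
      ((gs (K - n) (iterBlockOf (K - n) x))⁻¹ * ν (K - n) (iterBlockOf (K - n) x)) * h' s * g s)
    (htop : ∀ yc ∈ Λs (K - n),
      κ' (K - n) (iterBlockOf (K - n) (cover (F.P K) ((((F.P K).L : ℤ) ^ (K - n)) • yc))) =
        axialT (dbarIterU (K - n) (gaugeActT g (unitsField (toUField U)))) (iterBlockOf (K - n) x)
          (iterBlockOf (K - n) (cover (F.P K) ((((F.P K).L : ℤ) ^ (K - n)) • yc)))) :
    DP1Clause F n K (cubeSeqMT3 F n K x ρ S M hM) x U u :=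
  dp1Clause_of_top F n K hnK x hM hNr hroom h0 ha Λs hΛ U u g h' κ' h0' hs' ν hν0 hνs gs hg0 hgs hε₀ hε hU hug fun yc hyc => by
    simpa only [iterBlockOf_cover_smul (FlatMinimizerH.le_T3 F n K)] using htop yc hyc

/-- **THE SAME AT J6's TORUS GAUGE** `u := fun s => suIncl (w (lift x + rel x s))` (the `SU(2)`-valued ℤ³ gauge `w` of the J4 pair read through the window
representative; ✓`HalvingP1FlatCoreJunction.junction_chart`, ✓`HalvingP1FlatCoreExtraction.core'_of_mlogChart`): the `ho : DP1Clause … (fun s => suIncl (u s))`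
row of the per-site checklist of record, from (top) + the factorisation `(suIncl (w (rep s)))⁻¹ = C·h′(s)·g(s)` + room.
[cite: Balaban1985Averaging, (8) p.19, (92) p.31, (97)-(100) p.32; Balaban1985Variational, (20) p.281, (144) p.300, (156) p.302] -/
theorem dp1Clause_of_top_junction (hnK : n < K) (x : Site (F.P K) 0) {ρ S M Nr : ℕ} (hM : 1 ≤ M) (hNr : M ≤ Nr)
    (hroom : 2 * ρ + Nr ≤ F.L ^ (F.m + n))
    {a : LSite (F.P K).d} {M' ρ' : ℕ} (h0 : ρ + M ≤ ρ' + 1)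
    (ha : ∀ ν, a ν ≤ ((iterBlockOf (K - n) x ν).val : ℤ) ∧ ((iterBlockOf (K - n) x ν).val : ℤ) ≤ a ν + M' - 1)
    (Λs : ℕ → Set (LSite (F.P K).d))
    (hΛ : ∀ yc : LSite (F.P K).d,
      InBox (sqLo (F.P K).L a ρ' (K - n) (K - n)) (sqHi (F.P K).L a M' ρ' (K - n) (K - n)) yc → yc ∈ Λs (K - n))
    (U : GaugeField (F.P K) 0 (Matrix.specialUnitaryGroup (Fin 2) ℂ)) (w : LSite (F.P K).d → Matrix.specialUnitaryGroup (Fin 2) ℂ)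
    (g h' : GaugeTransf (F.P K) 0 (Matrix (Fin 2) (Fin 2) ℂ)ˣ)
    (κ' : (i : ℕ) → GaugeTransf (F.P K) i (Matrix (Fin 2) (Fin 2) ℂ)ˣ) (h0' : κ' 0 = h')
    (hs' : ∀ (i : ℕ) (y : Site (F.P K) (i + 1)),
      κ' (i + 1) y = (vframeU (gaugeActT (κ' i) (dbarIterU i (gaugeActT g (unitsField (toUField U))))) y)⁻¹ * κ' i (emb y) *
        vframeU (dbarIterU i (gaugeActT g (unitsField (toUField U)))) y)
    (ν : (i : ℕ) → Site (F.P K) i → (Matrix (Fin 2) (Fin 2) ℂ)ˣ) (hν0 : ∀ s, ν 0 s = 1)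
    (hνs : ∀ (i : ℕ) (y : Site (F.P K) (i + 1)),
      ν (i + 1) y = ν i (emb y) * vframeU (dbarIterU i (gaugeActT g (unitsField (toUField U)))) y)
    (gs : (i : ℕ) → GaugeTransf (F.P K) i (Matrix (Fin 2) (Fin 2) ℂ)ˣ) (hg0 : gs 0 = g)
    (hgs : ∀ (i : ℕ) (y : Site (F.P K) (i + 1)), gs (i + 1) y = gs i (emb y))
    {ε₀ : ℝ} (hε₀ : 0 < ε₀) (hε : 10 ^ 7 * (F.L : ℝ) ^ 3 * ε₀ ≤ 1) (hU : PlaqSmall (regThreshold F n K ε₀) U)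
    (hug : ∀ s, (Unitary.toUnits (suIncl (w (lift (F.P K) x + rel x s))))⁻¹ =
      ((gs (K - n) (iterBlockOf (K - n) x))⁻¹ * ν (K - n) (iterBlockOf (K - n) x)) * h' s * g s)
    (htop : ∀ yc ∈ Λs (K - n),
      κ' (K - n) (coverAt (F.P K) (K - n) yc) =
        axialT (dbarIterU (K - n) (gaugeActT g (unitsField (toUField U)))) (iterBlockOf (K - n) x) (coverAt (F.P K) (K - n) yc)) :
    DP1Clause F n K (cubeSeqMT3 F n K x ρ S M hM) x U (fun s => suIncl (w (lift (F.P K) x + rel x s))) :=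
  dp1Clause_of_top F n K hnK x hM hNr hroom h0 ha Λs hΛ U _ g h' κ' h0' hs' ν hν0 hνs gs hg0 hgs hε₀ hε hU hug htop

end Summit.QuantumFields.YangMills.Theorems.HalvingP1FlatCoreDP1OfTop
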